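import Mathlib
import HarnessLib

/-!
# ValiantsHypothesis / LacunarySymmetroid — crux `MatrixDescartes` (stmt-ValiantsHypothesis-18050, V1),
# LINE (A) «product_plus_one», research stub `stub_classRowK3`: the MIDDLE coupling — structure of a NO-DIP factor seen from the middle letter

Sector of record (val-lit desk #311 default, p7 g14's sector map §10/§12): `K = 3`, support `d 0 < d 1 < d 2`, coupled letter `l₀ = 1`
(the MIDDLE one), NO-DIP factors `f_j = a_{j0} X^{d 0} + a_{j1} X^{d 1} + a_{j2} X^{d 2}` with `a_{j0}·a_{j2} < 0`.  With `p = d 1 − d 0`,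
`r = d 2 − d 1` the reduced factor is the LAURENT trinomial `k_j(x) = f_j(x)/x^(d 1) = a_{j0} x^(−p) + a_{j1} + a_{j2} x^r` (monomial ends of
OPPOSITE exponent sign — p7 g14's memo §10: no power chart/weight certificate; the self-dual case of `x ↦ 1/x`).  What IS elementary:

* `euler_letter_middle_one_signed` — the Euler letter `B_j = θ_{d 1} f_j = a_{j0}(d 0 − d 1) X^(d 0) + a_{j2}(d 2 − d 1) X^(d 2)` of
  ✓ `ProductPlusOne.euler_fewnomial` at `l₀ = 1` is ONE-SIGNED on `(0,∞)` (sign of `a_{j2}`): no-dip letters never vanish, so the c-free numerator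
  `Σ_j B_j ∏_{i≠j} f_i` of ✓ `card_pos_roots_class_le_euler` has one-signed letters in this sector;
* `laurent_factor_strictAntiOn` / `laurent_factor_strictMonoOn` — `x ↦ a/x^p + b + c x^r` is STRICTLY MONOTONE on `(0,∞)` when `a c < 0`
  (every `b`, every ratio): the reduced factor has at most one zero;
* `logWronskian_nodip_subsingleton` — the log-Wronskian `p² ab x^p + q² ac x^q + (q−p)² bc x^(p+q)` (`q = d 2 − d 0`) of a no-dip trinomial
  has AT MOST ONE positive zero (divided by `x^p`, resp. `x^(p+q)`, it is a constant plus a strictly monotone function, by the sign of `b`):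
  the `s`-chart log-derivative `θ ln f_j` has at most one turning abscissa — «rise-then-fall» or «fall-then-rise» around its pole.

These are the inputs of the located middle-coupling lemma («on each zero-free component, `Σ_j θ ln|k_j|` has ≤ 2 zeros» ⇒ `Z₊ ≤ 2m + 3`),
which stays OPEN (p7 §8 decay lemma / p3 g16 CONJECTURE T′, mixed-sign exponents).  Honest framing: structure lemmas of a sector of a research
stub; NOT `stub_classRowK3`, `stub_polyLaw`, `ProductPlusOneMDR`, `MatrixDescartes`, Conjecture B; `VP ≠ VNP` NOT proved.  No definitions,
no named facts; Mathlib only.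
-/

set_option linter.dupNamespace false

namespace Summit.ValiantsHypothesis.ValiantsHypothesis.Theorems.LacunarySymmetroidMatrixDescartes

namespace ProductPlusOne

open Polynomial

/-! ### (L1) The Euler letter at the middle coupling is one-signed -/

/-- **No-dip letters do not vanish at the middle coupling**: for `d 0 < d 1 < d 2`, `a0·a2 < 0`, `x > 0`,
`a2 · (a0 (d 0 − d 1) x^(d 0) + a2 (d 2 − d 1) x^(d 2)) > 0`. [folklore] -/
theorem euler_letter_middle_one_signed (d : Fin 3 → ℕ) (h01 : d 0 < d 1) (h12 : d 1 < d 2) (a0 a2 : ℝ) (hac : a0 * a2 < 0)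
    {x : ℝ} (hx : 0 < x) :
    0 < a2 * (a0 * ((d 0 : ℝ) - d 1) * x ^ d 0 + a2 * ((d 2 : ℝ) - d 1) * x ^ d 2) := by
  have h1 : (d 0 : ℝ) - d 1 < 0 := by
    have : (d 0 : ℝ) < d 1 := by exact_mod_cast h01
    linarith
  have h2 : 0 < (d 2 : ℝ) - d 1 := by
    have : (d 1 : ℝ) < d 2 := by exact_mod_cast h12
    linarith
  have hx0 : 0 < x ^ d 0 := pow_pos hx _
  have hx2 : 0 < x ^ d 2 := pow_pos hx _
  have hA : 0 < a2 * a0 * ((d 0 : ℝ) - d 1) := by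
    have : a2 * a0 < 0 := by rw [mul_comm]; exact hac
    exact mul_pos_of_neg_of_neg this h1
  have hB : 0 < a2 * a2 * ((d 2 : ℝ) - d 1) := by
    have hne : a2 ≠ 0 := by rintro rfl; rw [mul_zero] at hac; exact lt_irrefl 0 hac
    exact mul_pos (mul_self_pos.2 hne) h2
  nlinarith [mul_pos hA hx0, mul_pos hB hx2]

/-! ### (L2) The reduced Laurent factor is monotone -/

/-- **Laurent monotonicity**: `x ↦ a/x^p + b + c x^r` is strictly DECREASING on `(0,∞)` for `a > 0 > c`, `p, r ≥ 1`. [folklore] -/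
theorem laurent_factor_strictAntiOn (a b c : ℝ) (p r : ℕ) (hp : 0 < p) (hr : 0 < r) (ha : 0 < a) (hc : c < 0) :
    StrictAntiOn (fun x : ℝ => a / x ^ p + b + c * x ^ r) (Set.Ioi 0) := by
  intro x hx y hy hxy
  have hx' : (0 : ℝ) < x := hx
  have hxp : x ^ p < y ^ p := pow_lt_pow_left₀ hxy hx'.le hp.ne'
  have hxr : x ^ r < y ^ r := pow_lt_pow_left₀ hxy hx'.le hr.ne'
  have h1 : a / y ^ p < a / x ^ p := div_lt_div_of_pos_left ha (pow_pos hx' p) hxp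
  have h2 : c * y ^ r < c * x ^ r := mul_lt_mul_of_neg_left hxr hc
  show a / y ^ p + b + c * y ^ r < a / x ^ p + b + c * x ^ r
  linarith

/-- **Laurent monotonicity**, mirror case: strictly INCREASING for `a < 0 < c`. [folklore] -/
theorem laurent_factor_strictMonoOn (a b c : ℝ) (p r : ℕ) (hp : 0 < p) (hr : 0 < r) (ha : a < 0) (hc : 0 < c) :
    StrictMonoOn (fun x : ℝ => a / x ^ p + b + c * x ^ r) (Set.Ioi 0) := by
  intro x hx y hy hxy
  have h := laurent_factor_strictAntiOn (-a) (-b) (-c) p r hp hr (neg_pos.2 ha) (neg_lt_zero.2 hc) hx hy hxy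
  simp only [neg_div] at h
  show a / x ^ p + b + c * x ^ r < a / y ^ p + b + c * y ^ r
  linarith

/-- Hence the reduced factor has AT MOST ONE positive zero (no-dip, `a c < 0`). [folklore] -/
theorem laurent_factor_zero_subsingleton (a b c : ℝ) (p r : ℕ) (hp : 0 < p) (hr : 0 < r) (hac : a * c < 0) :
    {x : ℝ | 0 < x ∧ a / x ^ p + b + c * x ^ r = 0}.Subsingleton := by
  rcases lt_trichotomy a 0 with ha | ha | ha
  · have hc : 0 < c := by nlinarith
    intro x hx y hy
    exact (laurent_factor_strictMonoOn a b c p r hp hr ha hc).injOn hx.1 hy.1 (hx.2.trans hy.2.symm)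
  · rw [ha, zero_mul] at hac; exact (lt_irrefl 0 hac).elim
  · have hc : c < 0 := by nlinarith
    intro x hx y hy
    exact (laurent_factor_strictAntiOn a b c p r hp hr ha hc).injOn hx.1 hy.1 (hx.2.trans hy.2.symm)

/-! ### (L3) The log-Wronskian of a no-dip trinomial has at most one positive zero -/

/-- **At most one positive zero of the no-dip log-Wronskian** `W(x) = p² ab x^p + q² ac x^q + (q−p)² bc x^(p+q)` (`0 < p < q`, `a c < 0`):
divided by `x^p` (if `a b ≥ 0`) resp. by `x^(p+q)` (if `a b < 0`) it is a constant plus a strictly monotone function. [folklore] -/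
theorem logWronskian_nodip_subsingleton (a b c : ℝ) (p q : ℕ) (hp : 0 < p) (hpq : p < q) (hac : a * c < 0) :
    {x : ℝ | 0 < x ∧ (p : ℝ) ^ 2 * (a * b) * x ^ p + (q : ℝ) ^ 2 * (a * c) * x ^ q
      + ((q : ℝ) - p) ^ 2 * (b * c) * x ^ (p + q) = 0}.Subsingleton := by
  have hq : 0 < q := lt_trans hp hpq
  have hqp : (0 : ℝ) < (q : ℝ) - p := by
    have : (p : ℝ) < q := by exact_mod_cast hpq
    linarith
  obtain ⟨k, hk⟩ : ∃ k, q = p + k + 1 := ⟨q - p - 1, by omega⟩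
  -- the sign of `a b` decides the normalisation
  intro x hx y hy
  obtain ⟨hx0, hxW⟩ := hx
  obtain ⟨hy0, hyW⟩ := hy
  by_contra hne
  -- reduce to `x < y` by symmetry
  wlog hxy : x < y generalizing x y
  · exact this hy0 hyW hx0 hxW (Ne.symm hne) (lt_of_le_of_ne (not_lt.1 hxy) (Ne.symm hne))
  -- `b c` and `a b` have opposite signs (or `b = 0`), since `a c < 0`
  by_cases hb : 0 ≤ a * b
  · -- divide by `x^p`: `W/x^p = p² ab + x^(q−p) (q² ac + (q−p)² bc x^p)`, the bracket NEGATIVE and the product strictly decreasing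
    have ha0 : a ≠ 0 := by rintro rfl; rw [zero_mul] at hac; exact lt_irrefl 0 hac
    have hbc : b * c ≤ 0 := by
      by_contra h
      push Not at h
      have h1 : (a * b) * (a * c) ≤ 0 := mul_nonpos_of_nonneg_of_nonpos hb hac.le
      have h2 : 0 < a ^ 2 := by positivity
      have h3 : (a * b) * (a * c) = a ^ 2 * (b * c) := by ring
      nlinarith [mul_pos h2 h]
    have key : ∀ z : ℝ, 0 < z → (p : ℝ) ^ 2 * (a * b) * z ^ p + (q : ℝ) ^ 2 * (a * c) * z ^ q
        + ((q : ℝ) - p) ^ 2 * (b * c) * z ^ (p + q) = z ^ p * ((p : ℝ) ^ 2 * (a * b)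
          + ((q : ℝ) ^ 2 * (a * c) * z ^ (k + 1) + ((q : ℝ) - p) ^ 2 * (b * c) * z ^ (p + k + 1))) := by
      intro z _; rw [hk]; ring
    -- the function `φ z = q² ac z^(k+1) + (q−p)² bc z^(p+k+1)` is strictly decreasing on (0,∞)
    have hmono : ∀ u v : ℝ, 0 < u → u < v →
        (q : ℝ) ^ 2 * (a * c) * v ^ (k + 1) + ((q : ℝ) - p) ^ 2 * (b * c) * v ^ (p + k + 1)
          < (q : ℝ) ^ 2 * (a * c) * u ^ (k + 1) + ((q : ℝ) - p) ^ 2 * (b * c) * u ^ (p + k + 1) := by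
      intro u v hu huv
      have h1 : u ^ (k + 1) < v ^ (k + 1) := pow_lt_pow_left₀ huv hu.le (by omega)
      have h2 : u ^ (p + k + 1) ≤ v ^ (p + k + 1) := (pow_lt_pow_left₀ huv hu.le (by omega)).le
      have hq2 : 0 < (q : ℝ) ^ 2 := by positivity
      nlinarith [mul_pos hq2 (neg_pos.2 hac), mul_nonneg (sq_nonneg ((q : ℝ) - p)) (neg_nonneg.2 hbc)]
    rw [key x hx0] at hxW; rw [key y hy0] at hyW
    have hxp : x ^ p ≠ 0 := pow_ne_zero _ hx0.ne'
    have hyp : y ^ p ≠ 0 := pow_ne_zero _ hy0.ne'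
    have e1 := (mul_eq_zero.1 hxW).resolve_left hxp
    have e2 := (mul_eq_zero.1 hyW).resolve_left hyp
    have := hmono x y hx0 hxy
    linarith
  · -- divide by `x^(p+q)`: `W/x^(p+q) = (q−p)² bc + (p² ab x^(−q) + q² ac x^(−p))`, the bracket strictly INCREASING (both terms negative ↑ 0)
    push Not at hb
    have key : ∀ z : ℝ, 0 < z → ((p : ℝ) ^ 2 * (a * b) * z ^ p + (q : ℝ) ^ 2 * (a * c) * z ^ q
        + ((q : ℝ) - p) ^ 2 * (b * c) * z ^ (p + q) = 0 ↔
          (p : ℝ) ^ 2 * (a * b) / z ^ q + (q : ℝ) ^ 2 * (a * c) / z ^ p + ((q : ℝ) - p) ^ 2 * (b * c) = 0) := by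
      intro z hz
      have hzpq : z ^ (p + q) ≠ 0 := pow_ne_zero _ hz.ne'
      have hzp : z ^ p ≠ 0 := pow_ne_zero _ hz.ne'
      have hzq : z ^ q ≠ 0 := pow_ne_zero _ hz.ne'
      constructor
      · intro h
        have := congrArg (fun w => w / z ^ (p + q)) h
        simp only [zero_div] at this
        rw [← this]
        field_simp
        ring
      · intro h
        have := congrArg (fun w => w * z ^ (p + q)) h
        simp only [zero_mul] at this
        rw [← this]
        field_simp
        ring
    rw [key x hx0] at hxW; rw [key y hy0] at hyW
    have h1 : (p : ℝ) ^ 2 * (a * b) / y ^ q > (p : ℝ) ^ 2 * (a * b) / x ^ q := by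
      have hxq : x ^ q < y ^ q := pow_lt_pow_left₀ hxy hx0.le hq.ne'
      have hneg : (p : ℝ) ^ 2 * (a * b) < 0 := mul_neg_of_pos_of_neg (by positivity) hb
      have h := div_lt_div_of_pos_left (neg_pos.2 hneg) (pow_pos hx0 q) hxq
      rw [neg_div, neg_div] at h
      linarith
    have h2 : (q : ℝ) ^ 2 * (a * c) / y ^ p > (q : ℝ) ^ 2 * (a * c) / x ^ p := by
      have hxp : x ^ p < y ^ p := pow_lt_pow_left₀ hxy hx0.le hp.ne'
      have hneg : (q : ℝ) ^ 2 * (a * c) < 0 := mul_neg_of_pos_of_neg (by positivity) hac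
      have h := div_lt_div_of_pos_left (neg_pos.2 hneg) (pow_pos hx0 p) hxp
      rw [neg_div, neg_div] at h
      linarith
    linarith

end ProductPlusOne

end Summit.ValiantsHypothesis.ValiantsHypothesis.Theorems.LacunarySymmetroidMatrixDescartes
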